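import Literature.NumberTheory.ModularSymbols.CuspidalHomologyEigenpacketLift
import HarnessLib

/-!
# A commuting family of ANY size has a joint eigenvector in a non-zero finite-dimensional stable subspace — kernel glue for the COFINITE (LIFT′)

Helper-only file (bsd-idea-10 g20, lens = transfer) for crux `EulerHalvesAtThree` (stmt-BirchSwinnertonDyer-19109) ∕ the Galois leaf (OBS) of the child node
`CartanOnePlaceDegreeLawAtThree` (stmt-…-24801). The print socket (LIFT′) `CartanCarayol.CuspidalEigenCochainLiftPrimeToCartanPlaceAtThree` (p742701) is
COFINITE: its eigen-hypothesis and its congruence conclusion run over all primes `ℓ` outside a finite set (the finite-`S` shape cannot feed (MOD), see the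
docstring there). The sibling's chain (`Literature…CuspidalHomologyEigenpacketLift`, § 1 `exists_joint_eigenvector_of_commute`, Hoffman–Kunze § 6.5 Thm. 7)
extracts a joint eigenvector for a FINITE commuting family (`s : Finset ι`). This file removes the finiteness: `exists_joint_eigenvector_of_commute_of_set` — for
a family `f : ι → End_K V` commuting on an arbitrary index set `P : Set ι`, and a non-zero finite-dimensional subspace `W` stable under every `f i` (`i ∈ P`),
there is `v ∈ W ∖ 0` with `f i v ∈ K v` for ALL `i ∈ P` (`K` algebraically closed). Proof: the restrictions `f i|_W` (`i ∈ P`) span a finite-dimensional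
subspace of `End_K W`; a finite linearly independent spanning subfamily (`exists_linearIndependent'`, `LinearIndependent.finite_of_isNoetherian`) has a joint
eigenvector by the finite case, and every other `f j|_W` is a `K`-linear combination of these (`Submodule.mem_span_range_iff_exists_fun`), hence has the same
vector as an eigenvector. This is the step «`m ∈ L`, `ann m = P` ⇒ an eigenform in the `ℂ`-span of `H • ES⁻¹(m) ⊆ S₂(Γ′)` for the algebra `H` generated by
infinitely many `T_ℓ`» of the discharge of (LIFT′).

THEOREMS ONLY (no `def`, no named fact, no `sorry`); generic linear algebra. No crux ∕ stub ∕ summit statement is proved; BSD is proved for no curve.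
[cite: HoffmanKunze1971LinearAlgebra, §6.5 Thm. 7 and Corollary (p. 207)]
-/

set_option linter.dupNamespace false
set_option autoImplicit false

noncomputable section

open scoped Classical

namespace Summit.BirchSwinnertonDyer.BirchSwinnertonDyer.Theorems.CartanCarayol

open Literature.NumberTheory.ModularSymbols

/-- **eigenvectors pass to linear combinations of operators**: if `v` is an eigenvector of each `g k` (`k : κ`, finite) then it is one of `Σ_k c_k • g k`. [folklore] -/
theorem exists_sum_smul_apply_eq_smul {K M : Type*} [Field K] [AddCommGroup M] [Module K M] {κ : Type*} [Fintype κ]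
    (g : κ → Module.End K M) (c : κ → K) (v : M) (hv : ∀ k, ∃ d : K, g k v = d • v) :
    ∃ d : K, (∑ k, c k • g k) v = d • v := by
  choose d hd using hv
  refine ⟨∑ k, c k * d k, ?_⟩
  rw [LinearMap.sum_apply, Finset.sum_smul]
  exact Finset.sum_congr rfl fun k _ ↦ by rw [LinearMap.smul_apply, hd k, smul_smul]

/-- **A COMMUTING FAMILY OF ANY SIZE HAS A JOINT EIGENVECTOR in every non-zero finite-dimensional stable subspace** (`K` algebraically closed). For
`f : ι → End_K V` pairwise commuting on `P : Set ι` (possibly infinite) and a finite-dimensional `W ≠ 0` with `f i (W) ⊆ W` for `i ∈ P`, some `v ∈ W`, `v ≠ 0`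
satisfies `f i v = c_i v` for every `i ∈ P`. (Finite case: `exists_joint_eigenvector_of_commute`; reduction: a finite linearly independent spanning subfamily
of the restrictions `f i|_W`.) [cite: HoffmanKunze1971LinearAlgebra, §6.5 Thm. 7 and Corollary (p. 207)] -/
theorem exists_joint_eigenvector_of_commute_of_set {K V : Type*} [Field K] [IsAlgClosed K] [AddCommGroup V] [Module K V] {ι : Type*}
    (P : Set ι) (f : ι → Module.End K V) (hc : ∀ i ∈ P, ∀ j ∈ P, Commute (f i) (f j)) (W : Submodule K V) [FiniteDimensional K W]
    (hW : ∀ i ∈ P, W ≤ W.comap (f i)) (hW0 : W ≠ ⊥) :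
    ∃ v ∈ W, v ≠ 0 ∧ ∀ i ∈ P, ∃ c : K, f i v = c • v := by
  classical
  -- the restrictions `g i : End_K W` of the `f i`, `i ∈ P`
  have hW' : ∀ i : P, ∀ w ∈ W, f i w ∈ W := fun i w hw ↦ hW i i.2 hw
  set g : P → Module.End K W := fun i ↦ (f i).restrict (hW' i) with hg
  have hg_apply : ∀ (i : P) (w : W), ((g i w : W) : V) = f i w := fun i w ↦ by
    rw [hg, LinearMap.restrict_apply]
  -- a finite linearly independent spanning subfamily `g ∘ a`, `a : κ → P`
  obtain ⟨κ, a, -, hspan, hli⟩ := exists_linearIndependent' K g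
  haveI : Finite κ := hli.finite_of_isNoetherian
  letI : Fintype κ := Fintype.ofFinite κ
  -- joint eigenvector for the finite subfamily, via the finite case applied to the ORIGINAL operators `f (a k)`
  let s : Finset ι := Finset.univ.image fun k : κ ↦ ((a k : P) : ι)
  have hsP : ∀ i ∈ s, i ∈ P := fun i hi ↦ by
    obtain ⟨k, -, rfl⟩ := Finset.mem_image.mp hi
    exact (a k).2
  obtain ⟨v, hvW, hv0, hv⟩ := exists_joint_eigenvector_of_commute s f (fun i hi j hj ↦ hc i (hsP i hi) j (hsP j hj)) W
    (fun i hi ↦ hW i (hsP i hi)) hW0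
  refine ⟨v, hvW, hv0, fun j hj ↦ ?_⟩
  -- `g j` is a combination of the `g (a k)`
  have hmem : g ⟨j, hj⟩ ∈ Submodule.span K (Set.range (g ∘ a)) := by
    rw [hspan]; exact Submodule.subset_span ⟨⟨j, hj⟩, rfl⟩
  obtain ⟨c, hcsum⟩ := (Submodule.mem_span_range_iff_exists_fun K).mp hmem
  -- each `g (a k)` has `⟨v, hvW⟩` as an eigenvector
  have hvk : ∀ k : κ, ∃ d : K, (g ∘ a) k ⟨v, hvW⟩ = d • ⟨v, hvW⟩ := fun k ↦ by
    obtain ⟨d, hd⟩ := hv _ (Finset.mem_image.mpr ⟨k, Finset.mem_univ _, rfl⟩)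
    exact ⟨d, Subtype.ext (by rw [Function.comp_apply, hg_apply, hd, Submodule.coe_smul])⟩
  obtain ⟨d, hd⟩ := exists_sum_smul_apply_eq_smul (g ∘ a) c ⟨v, hvW⟩ hvk
  refine ⟨d, ?_⟩
  have e : (((∑ k, c k • (g ∘ a) k) ⟨v, hvW⟩ : W) : V) = ((d • (⟨v, hvW⟩ : W) : W) : V) := congrArg Subtype.val hd
  rw [hcsum, hg_apply, Submodule.coe_smul] at e
  exact e

end Summit.BirchSwinnertonDyer.BirchSwinnertonDyer.Theorems.CartanCarayol

end
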